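import Literature.Computability.AlgebraicComplexity.ValiantReductionMachine
import Literature.Computability.AlgebraicComplexity.PermanentCodeTranscoder
import Literature.Computability.Complexity.CountingReductionsProofs
import Literature.Computability.Complexity.SharpSATNormalFormFP
import HarnessLib

/-!
# Valiant's theorem by the junction-gadget route: `#P ⊆ FP^{per01}` (a second, independent proof)

`theorem ValiantFP.isSharpPHardFun_per01PlainFn : IsSharpPHardFun per01PlainFn` — Valiant 1979,
Thm. 1, in the row-major word format of `PermanentBitsPPoly.lean`. The tree's discharge of the named
facts `Valiant1979_per01Plain_isSharpPHardFun` / `permanent01_isSharpPHardFun` is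
`QuantumComplexity/PermanentHardnessProofs.lean` (two-site arithmetisation `CNFPermanentTwoSite`,
modulus `2^{9m} + 1`), landed by a parallel seat while this chain was in review; this file is the
capstone of the OTHER formalised route, kept as an independent second proof and as the client of the
`ValiantFP` machine files:

* `#3SAT` is `#P`-complete under parsimonious reductions (`isSharpPCompleteParsimonious_SHARP3SAT`);
* for a 3-CNF `ψ` with `m` clauses, `numSat ψ = (per (valiant01 ψ) mod (2^{15m} + 1)) / 16^{3m}`
  for the explicit `0/1` matrix `valiant01 ψ` of size `N = 34m + (34m)² (15m + 2)`
  (`Valiant3CNFFlat.numSat_eq`: clause DAGs and Bürgisser–Clausen–Shokrollahi junction gadgets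
  applied all at once, `CNFPermanent`, `ValiantAllAtOnce`, `Valiant3CNFMatrix`; `-1 ≡ 2^q` and
  weights `2^k` by tournament gadgets, `PermanentBypass`, `PermanentZeroOneFlat`);
* the map `⌜ψ⌝ ↦` (row-major word of `valiant01 ψ`) is the `FP` brick `ValiantFP.redF`
  (`ValiantReductionMachine.redF_apply`, machine parts I–V), the answer is decoded by
  `ValiantFP.postF`, and one oracle query (`self_mem_FPRel`, `postPre_mem_FPRel`) assembles the
  `FP^{per01}` machine. Here: the word is the row-major word of `valiant01 ψ` (`wordBits_word`,
  `bitMatrix_word`, `per01PlainFn_word`).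

## References

* L. G. Valiant, *The complexity of computing the permanent*, Theoret. Comput. Sci. 8 (1979)
  189–201, Thm. 1, Lemma 3.1, Lemma 3.3, Prop. 3.4.
* P. Bürgisser, M. Clausen, M. A. Shokrollahi, *Algebraic Complexity Theory*, Springer 1997,
  Thm. (21.29) (the junction gadget).
* C. H. Papadimitriou, *Computational Complexity*, Addison-Wesley 1994, Thm. 18.3.
* S. Arora, B. Barak, *Computational Complexity: A Modern Approach*, CUP 2009, Thm. 17.11, §17.3.1.
-/

noncomputable section

namespace Literature.Computability.AlgebraicComplexity

open _root_.Computability Literature.Computability.Complexity Brick OracleCompose Polynomial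
open Literature.LinearAlgebra.Matrix Valiant3CNF KSATRed ValiantFP

/-! ### The word is the row-major word of `valiant01 ψ` -/

variable (ψ : CNF ℕ)

/-- Length of the word: `N²`. [folklore] -/
theorem length_word : (word ψ).length = Nsz ψ.length * Nsz ψ.length := by
  rw [word, length_ccat_const _ (m := 1) (fun _ => rfl), Nat.mul_one]

/-- **The bits of the word are the entries of `valiant01 ψ`.** [cite: Valiant1979, Thm. 1] -/
theorem wordBits_word (i j : Fin (Nsz ψ.length)) :
    wordBits (word ψ) (Nsz ψ.length) (i, j) = decide (valiant01 ψ i j = 1) := by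
  have hN : 0 < Nsz ψ.length := Fin.pos i
  have hij : i.val * Nsz ψ.length + j.val < Nsz ψ.length * Nsz ψ.length := by
    have := i.isLt; have := j.isLt; nlinarith
  rw [wordBits, word, show i.val * Nsz ψ.length + j.val = (i.val * Nsz ψ.length + j.val) * 1 + 0 by omega,
    getD_ccat_const _ (m := 1) (fun _ => rfl) false _ hij Nat.zero_lt_one]
  have h1 : (i.val * Nsz ψ.length + j.val) / Nsz ψ.length = i.val := by
    rw [Nat.mul_comm, Nat.mul_add_div hN, Nat.div_eq_of_lt j.isLt, Nat.add_zero]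
  have h2 : (i.val * Nsz ψ.length + j.val) % Nsz ψ.length = j.val := by
    rw [Nat.mul_comm, Nat.mul_add_mod, Nat.mod_eq_of_lt j.isLt]
  simp only [List.getD_cons_zero, h1, h2, valiant01, flat_apply]

/-- **The `0/1` matrix of the word is `valiant01 ψ`.** [cite: Valiant1979, Thm. 1] -/
theorem bitMatrix_word : bitMatrix (Nsz ψ.length) (wordBits (word ψ) (Nsz ψ.length)) = valiant01 ψ := by
  ext i j
  rw [bitMatrix, Matrix.of_apply, wordBits_word]
  rcases valiant01_zero_one ψ i j with h | h <;> simp [h]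

/-- **`per01PlainFn (word ψ) = per (valiant01 ψ)`** (as a natural number). [cite: Valiant1979, Thm. 1] -/
theorem per01PlainFn_word : per01PlainFn (word ψ) = ((valiant01 ψ).permanent).toNat := by
  rw [per01PlainFn, length_word, Nat.sqrt_eq, if_pos rfl, bitMatrix_word]
  rfl

/-! ### Valiant's theorem -/

/-- **Valiant's theorem** (Valiant 1979, Thm. 1), junction-gadget route: the permanent of `0/1`
matrices is `#P`-hard — every `g ∈ #P` is computed by a polynomial-time machine with one query to
`per01PlainFn` (parsimonious reduction to `#3SAT`, Valiant's matrix `valiant01` in word format,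
`numSat = (per mod (2^{15m}+1)) / 16^{3m}`). An independent second proof of the statement of
`Valiant1979_per01Plain_isSharpPHardFun_holds` (`QuantumComplexity/PermanentHardnessProofs.lean`).
[cite: Valiant1979, Thm. 1] -/
theorem ValiantFP.isSharpPHardFun_per01PlainFn : IsSharpPHardFun per01PlainFn := by
  intro g hg
  obtain ⟨R₁, hR₁, hgR⟩ := isSharpPCompleteParsimonious_SHARP3SAT.2 g hg
  have h := postPre_mem_FPRel (O := Oracle.ofFun per01PlainFn) (self_mem_FPRel _)
    (comp_mem_FP redF_mem_FP hR₁)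
    (comp_mem_FP postF_mem_FP (fanoutFn_mem_FP (comp_mem_FP canonCNFFn_mem_FP (comp_mem_FP hR₁ fstF_mem_FP)) sndF_mem_FP))
  refine (funext fun x => ?_ : (encodeNat ∘ g) = _) ▸ h
  simp only [Function.comp_apply, fanoutFn_apply, fstF_boolPair, sndF_boolPair, canonCNFFn_eq, Oracle.ofFun,
    redF_apply, hgR x, SHARP3SAT_eq_decCNF]
  have hpow : ∀ k : ℕ, (16 : ℕ) ^ (3 * k) = 2 ^ (12 * k) := fun k => by
    rw [show (16 : ℕ) = 2 ^ 4 by norm_num, ← pow_mul]; congr 1; ring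
  by_cases hv : CNF.IsWidthEq 3 (NegCNF.decCNF (R₁ x))
  · rw [if_pos hv, if_pos hv, per01PlainFn_word, postF_apply, if_pos hv, numSat_eq _ hv, hpow]
  · rw [if_neg hv, if_neg hv, postF_apply, if_neg hv]

end Literature.Computability.AlgebraicComplexity
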